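import Summits.QuantumFields.YangMills.Theorems.BalabanUVNodesN19LawPriceJackson

/-!
# YM-DAG node N19 (= NE7 proper) — TENSOR BERNSTEIN: multivariate approximation and moment pricing on the cube (towards a JOINT-LAW RATE)

Cell `pub-ymgap`, HUMAN RULING D-0062 (Track A), R141 (C) wider-strategy seat `pub-ymgap-dag-n19-e` (strategy s3 = ALTERNATIVE CURRENCY), generation
g19, module 3 (lineage module 55).  Route `Summits/QuantumFields/YangMills/Theses/BalabanUVNodes.lean` rev 25, cluster item K3⁷ «SpineGivenEndpointR13SepCoPH»
(stmt-QuantumFields-20544, dag-lead WORDS-143); filed `--supports` that item `--as helper` (it proves no registered stub).  COUNT-NEUTRAL: [folklore] real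
analysis over Mathlib (`bernstein`, `bernstein.probability` ∕ `.variance`, `Fintype.prod_sum`) + the seat's p546312 `…N19LawPriceUpper`
(`sum_abs_sub_mul_bernstein_le`, `sqrt_mul_one_sub_div_le`) and p554543 `…N19LawPriceJackson` (`sum_abs_coeff_C_mul`, `sum_abs_coeff_X_sub_C_mul_le`,
`sum_abs_coeff_one`) BY NAME; Mathlib-generic, no scheme object; NOT a discharge claim.

THE POINT.  The seat's law-level theory prices ONE string observable: p556871's `log(e+L_K)∕(1+L_K)` (Jackson) for the one-dimensional laws.  For the
JOINT law of several strings (p558060) no rate was typed («needs a multivariate Jackson theorem»).  The TENSOR-PRODUCT BERNSTEIN operator is the cheap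
multivariate substitute: it is linear, positive, explicit, and its coefficients against monomials are binomial.  This module supplies the two generic halves:
* §1 ★ `abs_tensorBernstein_sub_le` — for `g` with `|g u − g v| ≤ K·Σ_i|u_i − v_i|` on `[0,1]^ι`:
  `|Σ_k g(k∕n)·∏_i b_{n,k_i}(y_i) − g(y)| ≤ K·Σ_i √(y_i(1−y_i)∕n) ≤ K·|ι|∕(2√n)` (the weights `∏_i b_{n,k_i}(y_i)` sum to `1`; coordinate `i` costs
  `Σ_m |m∕n − y_i| b_{n,m}(y_i) ≤ √(y_i(1−y_i)∕n)` by p546312's Cauchy–Schwarz);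
* §2 ★ `abs_integral_prod_eval_sub_le` — PRICING: if two probability laws on `ℝ^ι` carried by `[−1,1]^ι` have all mixed moments of coordinate degrees `≤ n`
  within `r`, then `|∫ ∏_i p_i(x_i) dP − ∫ ∏_i p_i(x_i) dQ| ≤ (∏_i ‖p_i‖_{ℓ¹}) · r` for univariate polynomials `p_i` of degree `≤ n`;
* §3 the transported Bernstein polynomials `C(n,k)·((X+1)∕2)^k·((1−X)∕2)^{n−k}` (displayed, never named): evaluation = `b_{n,k}((1+x)∕2)`, degree `≤ n`,
  `ℓ¹` coefficient mass `≤ C(n,k)` — so the tensor Bernstein polynomial of a `G`-bounded `g` is priced at `G·2^{n|ι|}·r` (★ `abs_integral_tensorBernstein_sub_le`).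
The sibling `…N19JointLawRate` assembles: `|∫ f dP − ∫ f dQ| ≤ 2K|ι|∕√n + G·2^{n|ι|}·r`, and at the scheme under uniform `Target` `r = r_K` is p482030's
string-independent expectation rate — the first RATE for the continuum JOINT laws.

HONEST FRAMING (binding).  [folklore] (Bernstein 1912 ∕ tensor-product Bernstein operators); Mathlib-generic; NO consumer in the DAG today; nothing of
Bałaban's instantiated; N19 NOT discharged; count-neutral.  Nothing continuum ∕ `ℝ⁴` ∕ OS ∕ mass-gap ∕ Clay.  0 `def` ∕ 0 `sorry`.
-/

noncomputable section

open Real Finset MeasureTheory ProbabilityTheory Polynomial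
open scoped unitInterval

namespace Summit.QuantumFields.YangMills.Theorems.BalabanUVNodesN19JointLawBernstein

open Summit.QuantumFields.YangMills.Theorems.BalabanUVNodesN19LawPriceUpper (sum_abs_sub_mul_bernstein_le sqrt_mul_one_sub_div_le)
open Summit.QuantumFields.YangMills.Theorems.BalabanUVNodesN19LawPriceJackson (sum_abs_coeff_C_mul sum_abs_coeff_X_sub_C_mul_le sum_abs_coeff_one)

variable {ι : Type*} [Fintype ι] [DecidableEq ι]

/-! ## §1 The tensor-product Bernstein operator approximates coordinatewise-Lipschitz functions at rate `|ι|∕√n` [folklore] -/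

/-- The tensor Bernstein weights `∏_i b_{n,k_i}(y_i)`, `k : ι → {0,…,n}`, sum to `1` (`Fintype.prod_sum` + Mathlib `bernstein.probability`). [folklore] -/
theorem sum_prod_bernstein_eq_one (n : ℕ) (y : ι → I) :
    ∑ k : ι → Fin (n + 1), ∏ i, bernstein n (k i) (y i) = 1 := by
  rw [← Fintype.prod_sum (fun i (m : Fin (n + 1)) => bernstein n m (y i))]
  exact Finset.prod_eq_one fun i _ => bernstein.probability n (y i)
    
omit [DecidableEq ι] in
/-- The tensor Bernstein weights are nonnegative. [folklore] -/
theorem prod_bernstein_nonneg (n : ℕ) (y : ι → I) (k : ι → Fin (n + 1)) : 0 ≤ ∏ i, bernstein n (k i) (y i) :=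
  Finset.prod_nonneg fun _ _ => bernstein_nonneg

/-- One coordinate's first absolute moment against the tensor weights: `Σ_k |k_i∕n − y_i|·∏_j b_{n,k_j}(y_j) ≤ √(y_i(1−y_i)∕n)` — the other coordinates
sum out (`Fintype.prod_sum`), coordinate `i` is p546312's `sum_abs_sub_mul_bernstein_le`. [folklore] -/
theorem sum_abs_sub_mul_prod_bernstein_le {n : ℕ} (hn : n ≠ 0) (y : ι → I) (i : ι) :
    ∑ k : ι → Fin (n + 1), |((k i : ℕ) : ℝ) / n - y i| * ∏ j, bernstein n (k j) (y j) ≤ Real.sqrt ((y i : ℝ) * (1 - y i) / n) := by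
  have hw : ∀ k : ι → Fin (n + 1), |((k i : ℕ) : ℝ) / n - y i| * ∏ j, bernstein n (k j) (y j) =
      ∏ j, ((if j = i then |((k j : ℕ) : ℝ) / n - y j| else 1) * bernstein n (k j) (y j)) := fun k => by
    rw [Finset.prod_mul_distrib, Fintype.prod_ite_eq']
  rw [Finset.sum_congr rfl fun k _ => hw k,
    ← Fintype.prod_sum (fun j (m : Fin (n + 1)) => (if j = i then |((m : ℕ) : ℝ) / n - y j| else 1) * bernstein n m (y j))]
  have hj : ∀ j, ∑ m : Fin (n + 1), (if j = i then |((m : ℕ) : ℝ) / n - y j| else 1) * bernstein n m (y j) =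
      if j = i then ∑ m : Fin (n + 1), |((m : ℕ) : ℝ) / n - y i| * bernstein n m (y i) else 1 := fun j => by
    split_ifs with h
    · subst h; rfl
    · simp only [one_mul]; exact bernstein.probability n (y j)
  rw [Finset.prod_congr rfl fun j _ => hj j, Fintype.prod_ite_eq' i
    (fun _ => ∑ m : Fin (n + 1), |((m : ℕ) : ℝ) / n - y i| * bernstein n m (y i))]
  exact sum_abs_sub_mul_bernstein_le hn (y i)

/-- ★ **TENSOR BERNSTEIN APPROXIMATION** [folklore]: for `g : (ι → ℝ) → ℝ` with `|g u − g v| ≤ K·Σ_i |u_i − v_i|` on the cube `[0,1]^ι` (`0 ≤ K`) and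
`n ≥ 1`, at every `y ∈ [0,1]^ι`: `|Σ_{k : ι → {0..n}} g(k∕n)·∏_i b_{n,k_i}(y_i) − g(y)| ≤ K·Σ_i √(y_i(1−y_i)∕n)`. -/
theorem abs_tensorBernstein_sub_le {g : (ι → ℝ) → ℝ} {K : ℝ} (hK0 : 0 ≤ K)
    (hK : ∀ u v : ι → ℝ, (∀ i, u i ∈ Set.Icc (0 : ℝ) 1) → (∀ i, v i ∈ Set.Icc (0 : ℝ) 1) → |g u - g v| ≤ K * ∑ i, |u i - v i|)
    {n : ℕ} (hn : n ≠ 0) (y : ι → I) :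
    |∑ k : ι → Fin (n + 1), g (fun i => ((k i : ℕ) : ℝ) / n) * ∏ i, bernstein n (k i) (y i) - g (fun i => (y i : ℝ))| ≤
      K * ∑ i, Real.sqrt ((y i : ℝ) * (1 - y i) / n) := by
  have hnr : (0 : ℝ) < n := by exact_mod_cast Nat.pos_of_ne_zero hn
  have hnode : ∀ k : ι → Fin (n + 1), ∀ i, ((k i : ℕ) : ℝ) / n ∈ Set.Icc (0 : ℝ) 1 := fun k i =>
    ⟨div_nonneg (Nat.cast_nonneg _) hnr.le, (div_le_one hnr).2 (by exact_mod_cast Nat.lt_succ_iff.1 (k i).2)⟩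
  have hy : ∀ i, (y i : ℝ) ∈ Set.Icc (0 : ℝ) 1 := fun i => (y i).2
  have hrepr : g (fun i => (y i : ℝ)) = ∑ k : ι → Fin (n + 1), g (fun i => (y i : ℝ)) * ∏ i, bernstein n (k i) (y i) := by
    rw [← Finset.mul_sum, sum_prod_bernstein_eq_one n y, mul_one]
  rw [hrepr, ← Finset.sum_sub_distrib]
  calc |∑ k : ι → Fin (n + 1), (g (fun i => ((k i : ℕ) : ℝ) / n) * ∏ i, bernstein n (k i) (y i) -
          g (fun i => (y i : ℝ)) * ∏ i, bernstein n (k i) (y i))|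
      ≤ ∑ k : ι → Fin (n + 1), |g (fun i => ((k i : ℕ) : ℝ) / n) * ∏ i, bernstein n (k i) (y i) -
          g (fun i => (y i : ℝ)) * ∏ i, bernstein n (k i) (y i)| := abs_sum_le_sum_abs _ _
    _ ≤ ∑ k : ι → Fin (n + 1), (K * ∑ i, |((k i : ℕ) : ℝ) / n - y i|) * ∏ i, bernstein n (k i) (y i) :=
        Finset.sum_le_sum fun k _ => by
          rw [← sub_mul, abs_mul, abs_of_nonneg (prod_bernstein_nonneg n y k)]
          exact mul_le_mul_of_nonneg_right (hK _ _ (hnode k) hy) (prod_bernstein_nonneg n y k)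
    _ = K * ∑ i, ∑ k : ι → Fin (n + 1), |((k i : ℕ) : ℝ) / n - y i| * ∏ j, bernstein n (k j) (y j) := by
        rw [Finset.sum_comm, Finset.mul_sum]
        refine Finset.sum_congr rfl fun k _ => ?_
        rw [Finset.mul_sum, Finset.mul_sum, Finset.sum_mul]
        exact Finset.sum_congr rfl fun i _ => by ring
    _ ≤ K * ∑ i, Real.sqrt ((y i : ℝ) * (1 - y i) / n) :=
        mul_le_mul_of_nonneg_left (Finset.sum_le_sum fun i _ => sum_abs_sub_mul_prod_bernstein_le hn y i) hK0

/-- … `≤ K·|ι|∕(2√n)` (p546312 `sqrt_mul_one_sub_div_le`). [folklore] -/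
theorem abs_tensorBernstein_sub_le_card {g : (ι → ℝ) → ℝ} {K : ℝ} (hK0 : 0 ≤ K)
    (hK : ∀ u v : ι → ℝ, (∀ i, u i ∈ Set.Icc (0 : ℝ) 1) → (∀ i, v i ∈ Set.Icc (0 : ℝ) 1) → |g u - g v| ≤ K * ∑ i, |u i - v i|)
    {n : ℕ} (hn : n ≠ 0) (y : ι → I) :
    |∑ k : ι → Fin (n + 1), g (fun i => ((k i : ℕ) : ℝ) / n) * ∏ i, bernstein n (k i) (y i) - g (fun i => (y i : ℝ))| ≤
      K * (Fintype.card ι / (2 * Real.sqrt n)) := by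
  refine (abs_tensorBernstein_sub_le hK0 hK hn y).trans (mul_le_mul_of_nonneg_left ?_ hK0)
  calc ∑ i, Real.sqrt ((y i : ℝ) * (1 - y i) / n) ≤ ∑ _i : ι, 1 / (2 * Real.sqrt n) :=
        Finset.sum_le_sum fun i _ => sqrt_mul_one_sub_div_le hn (y i)
    _ = Fintype.card ι / (2 * Real.sqrt n) := by rw [Finset.sum_const, Finset.card_univ, nsmul_eq_mul]; ring

/-! ## §2 Pricing products of univariate polynomials against mixed-moment differences [folklore] -/

omit [DecidableEq ι] in
/-- A continuous function is integrable against a probability law on `ℝ^ι` carried by the cube `[−1,1]^ι` (bounded on the compact cube). [folklore] -/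
theorem integrable_of_continuous_of_cube {P : Measure (ι → ℝ)} [IsProbabilityMeasure P]
    (hP : P (Set.pi Set.univ (fun _ : ι => Set.Icc (-1 : ℝ) 1))ᶜ = 0) {h : (ι → ℝ) → ℝ} (hh : Continuous h) : Integrable h P := by
  obtain ⟨C, hC⟩ := (isCompact_univ_pi fun _ : ι => (isCompact_Icc : IsCompact (Set.Icc (-1 : ℝ) 1))).exists_bound_of_continuousOn
    hh.continuousOn
  have hae : ∀ᵐ x ∂P, x ∈ Set.pi Set.univ (fun _ : ι => Set.Icc (-1 : ℝ) 1) := mem_ae_iff.2 hP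
  exact (integrable_const C).mono' hh.aestronglyMeasurable (hae.mono fun x hx => hC x hx)

/-- A product of univariate polynomial evaluations is a finite combination of mixed monomials: `∏_i p_i(x_i) = Σ_{j : ι → {0..N−1}} (∏_i [x^{j_i}]p_i)·∏_i x_i^{j_i}`
when every `p_i` has degree `< N`. [bookkeeping] -/
theorem prod_eval_eq_sum (p : ι → ℝ[X]) {N : ℕ} (hp : ∀ i, (p i).natDegree < N) (x : ι → ℝ) :
    ∏ i, (p i).eval (x i) = ∑ j : ι → Fin N, (∏ i, (p i).coeff (j i)) * ∏ i, x i ^ (j i : ℕ) := by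
  classical
  have h : ∀ i, (p i).eval (x i) = ∑ m : Fin N, (p i).coeff m * x i ^ (m : ℕ) := fun i => by
    rw [Polynomial.eval_eq_sum_range' (hp i), Finset.sum_range]
  simp_rw [h]
  rw [Fintype.prod_sum]
  exact Finset.sum_congr rfl fun j _ => Finset.prod_mul_distrib

/-- ★ **PRICING A PRODUCT OF UNIVARIATE POLYNOMIALS** [folklore]: two probability laws `P`, `Q` on `ℝ^ι` carried by `[−1,1]^ι` whose mixed moments of
coordinate degrees `≤ n` differ by at most `r` integrate `∏_i p_i(x_i)` (each `deg p_i ≤ n`) within `(∏_i Σ_{m≤n} |[x^m]p_i|)·r`. -/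
theorem abs_integral_prod_eval_sub_le {P Q : Measure (ι → ℝ)} [IsProbabilityMeasure P] [IsProbabilityMeasure Q]
    (hP : P (Set.pi Set.univ (fun _ : ι => Set.Icc (-1 : ℝ) 1))ᶜ = 0) (hQ : Q (Set.pi Set.univ (fun _ : ι => Set.Icc (-1 : ℝ) 1))ᶜ = 0)
    {n : ℕ} {r : ℝ}
    (hmom : ∀ j : ι → Fin (n + 1), |∫ x, ∏ i, x i ^ (j i : ℕ) ∂P - ∫ x, ∏ i, x i ^ (j i : ℕ) ∂Q| ≤ r)
    (p : ι → ℝ[X]) (hp : ∀ i, (p i).natDegree ≤ n) :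
    |∫ x, ∏ i, (p i).eval (x i) ∂P - ∫ x, ∏ i, (p i).eval (x i) ∂Q| ≤ (∏ i, ∑ m ∈ range (n + 1), |(p i).coeff m|) * r := by
  classical
  have hexp := prod_eval_eq_sum p (fun i => Nat.lt_succ_of_le (hp i) : ∀ i, (p i).natDegree < n + 1)
  have hmono : ∀ j : ι → Fin (n + 1), Continuous fun x : ι → ℝ => ∏ i, x i ^ (j i : ℕ) := fun j =>
    continuous_finsetProd _ fun i _ => (continuous_apply i).pow _
  have hIP : ∀ j : ι → Fin (n + 1), Integrable (fun x : ι → ℝ => (∏ i, (p i).coeff (j i)) * ∏ i, x i ^ (j i : ℕ)) P := fun j =>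
    (integrable_of_continuous_of_cube hP (hmono j)).const_mul _
  have hIQ : ∀ j : ι → Fin (n + 1), Integrable (fun x : ι → ℝ => (∏ i, (p i).coeff (j i)) * ∏ i, x i ^ (j i : ℕ)) Q := fun j =>
    (integrable_of_continuous_of_cube hQ (hmono j)).const_mul _
  simp_rw [hexp]
  rw [integral_finsetSum _ fun j _ => hIP j, integral_finsetSum _ fun j _ => hIQ j, ← Finset.sum_sub_distrib]
  calc |∑ j : ι → Fin (n + 1), (∫ x, (∏ i, (p i).coeff (j i)) * ∏ i, x i ^ (j i : ℕ) ∂P -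
          ∫ x, (∏ i, (p i).coeff (j i)) * ∏ i, x i ^ (j i : ℕ) ∂Q)|
      ≤ ∑ j : ι → Fin (n + 1), |∫ x, (∏ i, (p i).coeff (j i)) * ∏ i, x i ^ (j i : ℕ) ∂P -
          ∫ x, (∏ i, (p i).coeff (j i)) * ∏ i, x i ^ (j i : ℕ) ∂Q| := abs_sum_le_sum_abs _ _
    _ ≤ ∑ j : ι → Fin (n + 1), (∏ i, |(p i).coeff (j i)|) * r := Finset.sum_le_sum fun j _ => by
        rw [integral_const_mul, integral_const_mul, ← mul_sub, abs_mul, Finset.abs_prod]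
        exact mul_le_mul_of_nonneg_left (hmom j) (Finset.prod_nonneg fun i _ => abs_nonneg _)
    _ = (∏ i, ∑ m ∈ range (n + 1), |(p i).coeff m|) * r := by
        rw [← Finset.sum_mul, Finset.prod_congr rfl fun i _ => Finset.sum_range fun m => |(p i).coeff m|, Fintype.prod_sum]

/-! ## §3 The transported Bernstein polynomials `C(n,k)·((X+1)∕2)^k·((1−X)∕2)^{n−k}`: evaluation, degree, `ℓ¹` mass [folklore] -/

/-- Evaluation: at `x ∈ ℝ`, `C(n,k)·((x+1)∕2)^k·((1−x)∕2)^{n−k} = b_{n,k}((1+x)∕2)` (Mathlib `bernstein_apply`). [bookkeeping] -/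
theorem eval_bernAff (n k : ℕ) (x : ℝ) (hx : x ∈ Set.Icc (-1 : ℝ) 1) :
    (C (n.choose k : ℝ) * (C (1 / 2 : ℝ) * (X + 1)) ^ k * (C (1 / 2 : ℝ) * (1 - X)) ^ (n - k)).eval x =
      bernstein n k ⟨(1 + x) / 2, by constructor <;> linarith [hx.1, hx.2]⟩ := by
  rw [bernstein_apply]
  simp only [eval_mul, eval_pow, eval_C, eval_add, eval_sub, eval_X, eval_one]
  ring

/-- Degree `≤ n` (for `k ≤ n`). [bookkeeping] -/
theorem natDegree_bernAff_le {n k : ℕ} (hk : k ≤ n) :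
    (C (n.choose k : ℝ) * (C (1 / 2 : ℝ) * (X + 1)) ^ k * (C (1 / 2 : ℝ) * (1 - X)) ^ (n - k)).natDegree ≤ n := by
  have h1 : (C (1 / 2 : ℝ) * (X + 1)).natDegree ≤ 1 :=
    (natDegree_C_mul_le _ _).trans (by simpa using natDegree_add_le (X : ℝ[X]) 1)
  have h2 : (C (1 / 2 : ℝ) * (1 - X)).natDegree ≤ 1 :=
    (natDegree_C_mul_le _ _).trans (by simpa using natDegree_sub_le (1 : ℝ[X]) X)
  calc (C (n.choose k : ℝ) * (C (1 / 2 : ℝ) * (X + 1)) ^ k * (C (1 / 2 : ℝ) * (1 - X)) ^ (n - k)).natDegree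
      ≤ (C (n.choose k : ℝ) * (C (1 / 2 : ℝ) * (X + 1)) ^ k).natDegree + ((C (1 / 2 : ℝ) * (1 - X)) ^ (n - k)).natDegree :=
        natDegree_mul_le
    _ ≤ k * 1 + (n - k) * 1 := by
        refine add_le_add ((natDegree_C_mul_le _ _).trans (natDegree_pow_le.trans (Nat.mul_le_mul_left _ h1)))
          (natDegree_pow_le.trans (Nat.mul_le_mul_left _ h2))
    _ = n := by rw [mul_one, mul_one, Nat.add_sub_cancel' hk]

/-- `ℓ¹` mass is preserved by the factor `(X+1)∕2` … [bookkeeping] -/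
theorem sum_abs_coeff_halfXAddOne_mul_le (q : ℝ[X]) (d : ℕ) :
    ∑ i ∈ range (d + 1), |(C (1 / 2 : ℝ) * (X + 1) * q).coeff i| ≤ ∑ i ∈ range (d + 1), |q.coeff i| := by
  have h : C (1 / 2 : ℝ) * (X + 1) * q = C (1 / 2 : ℝ) * ((X - C (-1 : ℝ)) * q) := by rw [map_neg, sub_neg_eq_add, map_one]; ring
  rw [h, sum_abs_coeff_C_mul]
  refine (mul_le_mul_of_nonneg_left (sum_abs_coeff_X_sub_C_mul_le (-1) q d) (abs_nonneg _)).trans (le_of_eq ?_)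
  rw [abs_neg, abs_one, abs_of_pos (by norm_num : (0 : ℝ) < 1 / 2)]
  ring

/-- … and by the factor `(1−X)∕2`. [bookkeeping] -/
theorem sum_abs_coeff_halfOneSubX_mul_le (q : ℝ[X]) (d : ℕ) :
    ∑ i ∈ range (d + 1), |(C (1 / 2 : ℝ) * (1 - X) * q).coeff i| ≤ ∑ i ∈ range (d + 1), |q.coeff i| := by
  have h : C (1 / 2 : ℝ) * (1 - X) * q = C (-(1 / 2) : ℝ) * ((X - C (1 : ℝ)) * q) := by rw [map_neg, map_one]; ring
  rw [h, sum_abs_coeff_C_mul]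
  refine (mul_le_mul_of_nonneg_left (sum_abs_coeff_X_sub_C_mul_le 1 q d) (abs_nonneg _)).trans (le_of_eq ?_)
  rw [abs_neg, abs_one, abs_of_pos (by norm_num : (0 : ℝ) < 1 / 2)]
  ring

/-- Powers of the two factors preserve `ℓ¹` mass. [bookkeeping] -/
theorem sum_abs_coeff_pow_mul_pow_mul_le (q : ℝ[X]) (d a b : ℕ) :
    ∑ i ∈ range (d + 1), |((C (1 / 2 : ℝ) * (X + 1)) ^ a * (C (1 / 2 : ℝ) * (1 - X)) ^ b * q).coeff i| ≤
      ∑ i ∈ range (d + 1), |q.coeff i| := by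
  induction a with
  | zero =>
    induction b generalizing q with
    | zero => simp
    | succ b ih =>
      rw [pow_zero, one_mul, pow_succ, mul_assoc]
      refine (ih _).trans' ?_
      rw [pow_zero, one_mul, mul_comm ((C (1 / 2 : ℝ) * (1 - X)) ^ b) (C (1 / 2 : ℝ) * (1 - X) * q), mul_assoc,
        mul_comm q]
      exact sum_abs_coeff_halfOneSubX_mul_le _ d
  | succ a ih =>
    rw [pow_succ, mul_comm ((C (1 / 2 : ℝ) * (X + 1)) ^ a) _, mul_assoc, mul_assoc]
    refine (sum_abs_coeff_halfXAddOne_mul_le _ d).trans ?_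
    rw [← mul_assoc]
    exact ih

/-- **`ℓ¹` MASS OF THE TRANSPORTED BERNSTEIN POLYNOMIAL `≤ C(n,k)`.** [folklore] -/
theorem sum_abs_coeff_bernAff_le (n k d : ℕ) :
    ∑ i ∈ range (d + 1), |(C (n.choose k : ℝ) * (C (1 / 2 : ℝ) * (X + 1)) ^ k * (C (1 / 2 : ℝ) * (1 - X)) ^ (n - k)).coeff i| ≤
      (n.choose k : ℝ) := by
  rw [mul_assoc, sum_abs_coeff_C_mul, Nat.abs_cast]
  refine mul_le_of_le_one_right (Nat.cast_nonneg _) ?_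
  have h := sum_abs_coeff_pow_mul_pow_mul_le (1 : ℝ[X]) d k (n - k)
  rw [mul_one, sum_abs_coeff_one] at h
  exact h

/-- ★ **PRICING THE TENSOR BERNSTEIN POLYNOMIAL** [folklore]: under the hypotheses of `abs_integral_prod_eval_sub_le` (`0 ≤ r`), for node values
`|c k| ≤ G`: `|∫ Σ_k c_k ∏_i B_{k_i}(x_i) dP − ∫ … dQ| ≤ G·2^{n·|ι|}·r`, `B_k = C(n,k)((X+1)∕2)^k((1−X)∕2)^{n−k}` (`Σ_k ∏_i C(n,k_i) = (2^n)^{|ι|}`). -/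
theorem abs_integral_tensorBernstein_sub_le {P Q : Measure (ι → ℝ)} [IsProbabilityMeasure P] [IsProbabilityMeasure Q]
    (hP : P (Set.pi Set.univ (fun _ : ι => Set.Icc (-1 : ℝ) 1))ᶜ = 0) (hQ : Q (Set.pi Set.univ (fun _ : ι => Set.Icc (-1 : ℝ) 1))ᶜ = 0)
    {n : ℕ} {r : ℝ} (hr : 0 ≤ r)
    (hmom : ∀ j : ι → Fin (n + 1), |∫ x, ∏ i, x i ^ (j i : ℕ) ∂P - ∫ x, ∏ i, x i ^ (j i : ℕ) ∂Q| ≤ r)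
    {c : (ι → Fin (n + 1)) → ℝ} {G : ℝ} (hc : ∀ k, |c k| ≤ G) :
    |∫ x, ∑ k : ι → Fin (n + 1), c k * ∏ i,
          (C (n.choose (k i) : ℝ) * (C (1 / 2 : ℝ) * (X + 1)) ^ (k i : ℕ) * (C (1 / 2 : ℝ) * (1 - X)) ^ (n - k i)).eval (x i) ∂P -
      ∫ x, ∑ k : ι → Fin (n + 1), c k * ∏ i,
          (C (n.choose (k i) : ℝ) * (C (1 / 2 : ℝ) * (X + 1)) ^ (k i : ℕ) * (C (1 / 2 : ℝ) * (1 - X)) ^ (n - k i)).eval (x i) ∂Q| ≤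
      G * 2 ^ (n * Fintype.card ι) * r := by
  classical
  have hG : 0 ≤ G := (abs_nonneg _).trans (hc fun _ => 0)
  -- the polynomials, coordinate by coordinate
  set B : (ι → Fin (n + 1)) → ι → ℝ[X] := fun k i =>
    C (n.choose (k i) : ℝ) * (C (1 / 2 : ℝ) * (X + 1)) ^ (k i : ℕ) * (C (1 / 2 : ℝ) * (1 - X)) ^ (n - k i) with hB
  have hcont : ∀ k : ι → Fin (n + 1), Continuous fun x : ι → ℝ => ∏ i, (B k i).eval (x i) := fun k =>
    continuous_finsetProd _ fun i _ => (Polynomial.continuous _).comp (continuous_apply i)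
  have hIP : ∀ k : ι → Fin (n + 1), Integrable (fun x : ι → ℝ => c k * ∏ i, (B k i).eval (x i)) P := fun k =>
    (integrable_of_continuous_of_cube hP (hcont k)).const_mul _
  have hIQ : ∀ k : ι → Fin (n + 1), Integrable (fun x : ι → ℝ => c k * ∏ i, (B k i).eval (x i)) Q := fun k =>
    (integrable_of_continuous_of_cube hQ (hcont k)).const_mul _
  have hprice : ∀ k : ι → Fin (n + 1), |∫ x, ∏ i, (B k i).eval (x i) ∂P - ∫ x, ∏ i, (B k i).eval (x i) ∂Q| ≤
      (∏ i, (n.choose (k i) : ℝ)) * r := fun k =>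
    (abs_integral_prod_eval_sub_le hP hQ hmom (B k) fun i => natDegree_bernAff_le (Nat.lt_succ_iff.1 (k i).2)).trans
      (mul_le_mul_of_nonneg_right (Finset.prod_le_prod (fun i _ => Finset.sum_nonneg fun _ _ => abs_nonneg _)
        fun i _ => sum_abs_coeff_bernAff_le n (k i) n) hr)
  show |∫ x, ∑ k : ι → Fin (n + 1), c k * ∏ i, (B k i).eval (x i) ∂P - ∫ x, ∑ k : ι → Fin (n + 1), c k * ∏ i, (B k i).eval (x i) ∂Q| ≤ _
  rw [integral_finsetSum _ fun k _ => hIP k, integral_finsetSum _ fun k _ => hIQ k, ← Finset.sum_sub_distrib]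
  calc |∑ k : ι → Fin (n + 1), (∫ x, c k * ∏ i, (B k i).eval (x i) ∂P - ∫ x, c k * ∏ i, (B k i).eval (x i) ∂Q)|
      ≤ ∑ k : ι → Fin (n + 1), |∫ x, c k * ∏ i, (B k i).eval (x i) ∂P - ∫ x, c k * ∏ i, (B k i).eval (x i) ∂Q| :=
        abs_sum_le_sum_abs _ _
    _ ≤ ∑ k : ι → Fin (n + 1), G * ((∏ i, (n.choose (k i) : ℝ)) * r) := Finset.sum_le_sum fun k _ => by
        rw [integral_const_mul, integral_const_mul, ← mul_sub, abs_mul]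
        exact mul_le_mul (hc k) (hprice k) (abs_nonneg _) hG
    _ = G * 2 ^ (n * Fintype.card ι) * r := by
        rw [← Finset.mul_sum, ← Finset.sum_mul, ← Fintype.prod_sum (fun i (m : Fin (n + 1)) => (n.choose (m : ℕ) : ℝ))]
        have h2 : ∀ i : ι, ∑ m : Fin (n + 1), (n.choose (m : ℕ) : ℝ) = 2 ^ n := fun i => by
          rw [← Finset.sum_range (fun m => (n.choose m : ℝ))]
          exact_mod_cast Nat.sum_range_choose n
        rw [Finset.prod_congr rfl fun i _ => h2 i, Finset.prod_const, Finset.card_univ, ← pow_mul, mul_assoc]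

end Summit.QuantumFields.YangMills.Theorems.BalabanUVNodesN19JointLawBernstein

end
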